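/-
Copyright (c) 2026 the pub-hodgecm-mathlib formalisation cell (harness21).  Prover seat hodgecm-mathlib-K2E3-p20 (g3), Track B «K2-LIT» ∕ h413 =
`stmt-HodgeConjecture-24833`, line `K2_E3_EllipticInputs`, unit U12 «Characters», socket #11 road (SC-an), brick (T20-f1) of the line lead's (T20-f)
PLAN (K2 bus 2026-09-04T02:03:12Z): the averaging step by which Harish-Chandra's Theorem 20 kills the truncated character integral off a height ball —
an integral over a right-`K`-invariant set vanishes as soon as every `K`-average of the integrand does.
-/
import Mathlib.MeasureTheory.Measure.Haar.Basic
import Mathlib.MeasureTheory.Group.Integral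
import Mathlib.MeasureTheory.Group.MeasurableEquiv
import Mathlib.MeasureTheory.Integral.Prod
import Mathlib.MeasureTheory.Function.LocallyIntegrable
import HarnessLib

/-!
# K2_E3 road (h413), socket #11 (SC-an), brick (T20-f1): INTEGRALS OVER RIGHT-`K`-INVARIANT SETS VANISH WHEN THE `K`-AVERAGES DO; CONJUGATING
# THE AVERAGING SUBGROUP; EVENTUAL CONSTANCY OF TRUNCATED INTEGRALS

Cell `pub/hodgecm-mathlib`, Track B «K2-LIT», crux H413 = `stmt-HodgeConjecture-24833` (`--supports … --as helper`, count-neutral).  This is the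
measure-theoretic step of [HarishChandra1970, Part VII §3 p. 71 eq. (1)] read WITHOUT Theorem 18: for `g = yγy⁻¹` regular non-elliptic the truncated
character integral is `Θₙ(g) = ∫_{Ω n} f_γ(x y) dx`; the shell `Ω n ∖ Ω R` is right-`K₁`-invariant, hence right-`K₀(y)`-invariant
(`K₀(y) = K₀ ∩ yK₀y⁻¹ ⊆ K₁`), and THEOREM 20 says the `K₀(y)`-average `∫_{K₀(y)} f_γ(x k y) dk = ∫_{y⁻¹K₀(y)y} f_γ(x y k′) dk′` vanishes for
`x ∉ Ω R`; so `∫_{Ω n ∖ Ω R} θ(xgx⁻¹) dx = 0`, whence `Θₙ(g) = ∫_{Ω n ∩ Ω R}` (the `hcanc` shape of ★ `K2E3SupercuspidalTruncatedCharDominationOfBricks`)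
and `Θₙ(g) = Θ_R(g)` for `n ≥ R` (the `hlim` shape of ★ `K2E3CharLocIntNearSemisimpleSupercuspidalOfTruncated`).  Generic locally compact group `G`,
right-invariant measure `μ` finite on compacta (every Haar measure of the unimodular `U(H)(L⁺_v)`, ★ `isInvInvariant_of_isHaarMeasure_cmDatum_local`):

* `setIntegral_comp_mul_right_eq_of_forall_mul_mem_iff` — `∫_S φ(x k) dx = ∫_S φ(x) dx` for `S·k = S`;
* **`setIntegral_eq_zero_of_forall_setIntegral_mul_eq_zero`** — `S` measurable, relatively compact, right-`K`-invariant (`K` a subgroup with compact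
  carrier of positive measure), `φ` continuous, `∀ x ∈ S, ∫_{K} φ(x k) dk = 0` ⊢ `∫_S φ = 0` (Fubini on `K × S` + right-invariance);
* `setIntegral_image_conj_eq` — `∫_{yKy⁻¹} φ(z) dz = ∫_K φ(y k y⁻¹) dk` for `μ` left- AND right-invariant (the passage `K₀(y) ↔ K′ = y⁻¹K₀(y)y`);
* `setIntegral_eq_setIntegral_inter_of_sdiff_eq_zero` ∕ `tendsto_setIntegral_of_forall_sdiff_eq_zero` — the two consumer shapes from the vanishing on
  the shells `Ω n ∖ Ω R` of a monotone family.

HONEST LABEL: HC_CM is proved only modulo the 7 printed citations (2 remaining named inputs: hLiu418 = stmt-HodgeConjecture-24832, h413 =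
stmt-HodgeConjecture-24833) until rung 0 closes; this file is a count-neutral helper.

## References
* [HarishChandra1970] Harish-Chandra (notes by G. van Dijk), *Harmonic Analysis on Reductive p-adic Groups*, LNM 162 (1970), Part VII §2 Theorem 20 p. 70,
  §3 p. 71 eq. (1), pp. 71–72.
* [Folland1995] G. B. Folland, *A Course in Abstract Harmonic Analysis* (1995), §2.4 Prop. 2.27 (unimodularity), §2.6 (Fubini on groups).
-/

set_option autoImplicit false
-- the mandated namespace repeats the single-problem summit's segment (`HodgeConjecture.HodgeConjecture`)
set_option linter.dupNamespace false

noncomputable section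

open MeasureTheory Measure Set Filter Topology
open scoped ENNReal Pointwise

namespace Summit.HodgeConjecture.HodgeConjecture.Cruxes.H413.K2E3RightInvariantSetIntegralVanishing

variable {G : Type*} [MeasurableSpace G] (μ : Measure G) {E : Type*} [NormedAddCommGroup E] [NormedSpace ℝ E]

/-! ## §1 Right translation by an element stabilising `S` -/

/-- **`∫_S φ(x k) dμ(x) = ∫_S φ(x) dμ(x)`** for a right-invariant `μ` and `k` with `S·k = S` (`x k ∈ S ↔ x ∈ S`): Mathlib `setIntegral_map_equiv` at the
measurable equivalence `x ↦ x k` with `map (· k) μ = μ`. [cite: Folland1995, §2.4] -/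
theorem setIntegral_comp_mul_right_eq_of_forall_mul_mem_iff [Group G] [MeasurableMul G] [μ.IsMulRightInvariant] (φ : G → E) {S : Set G} (k : G)
    (hk : ∀ x, x * k ∈ S ↔ x ∈ S) :
    ∫ x in S, φ (x * k) ∂μ = ∫ x in S, φ x ∂μ := by
  have hpre : (MeasurableEquiv.mulRight k) ⁻¹' S = S := by
    ext x; rw [Set.mem_preimage, MeasurableEquiv.coe_mulRight]; exact hk x
  have h := setIntegral_map_equiv (μ := μ) (MeasurableEquiv.mulRight k) φ S
  rw [hpre] at h
  simp only [MeasurableEquiv.coe_mulRight] at h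
  rw [← h, map_mul_right_eq_self μ k]

/-! ## §2 The averaging lemma -/

/-- **AN INTEGRAL OVER A RIGHT-`K`-INVARIANT SET VANISHES WHEN ALL ITS `K`-AVERAGES DO.**  `μ` right-invariant and finite on compacta, `K ≤ G` a
subgroup with compact carrier of positive measure (e.g. compact open), `S` measurable and relatively compact with `S·K ⊆ S`, `φ : G → E` continuous;
if `∫_K φ(x k) dμ(k) = 0` for every `x ∈ S` then `∫_S φ dμ = 0`.  Proof: `μ(K)·∫_S φ = ∫_K ∫_S φ(x k) dx dk` (§1) `= ∫_S ∫_K φ(x k) dk dx = 0`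
(Fubini on the finite product `μ|K ⊗ μ|S`, the integrand being continuous on the compact `K × S̄`). [cite: HarishChandra1970, Part VII §3 p. 71 eq. (1)]
[cite: Folland1995, §2.6] -/
theorem setIntegral_eq_zero_of_forall_setIntegral_mul_eq_zero [Group G] [TopologicalSpace G] [IsTopologicalGroup G] [BorelSpace G] [T2Space G]
    [LocallyCompactSpace G] [SecondCountableTopology G] [CompleteSpace E] [IsFiniteMeasureOnCompacts μ] [μ.IsMulRightInvariant]
    (K : Subgroup G) (hKc : IsCompact (K : Set G)) (hKpos : μ (K : Set G) ≠ 0)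
    {S : Set G} (hSm : MeasurableSet S) (hSc : IsCompact (closure S)) (hSK : ∀ x ∈ S, ∀ k ∈ K, x * k ∈ S)
    (φ : G → E) (hφ : Continuous φ) (h0 : ∀ x ∈ S, ∫ k in (K : Set G), φ (x * k) ∂μ = 0) :
    ∫ x in S, φ x ∂μ = 0 := by
  -- right-`K`-invariance as an equivalence
  have hiff : ∀ k ∈ K, ∀ x, x * k ∈ S ↔ x ∈ S := fun k hk x =>
    ⟨fun h => by simpa using hSK (x * k) h k⁻¹ (K.inv_mem hk), fun h => hSK x h k hk⟩
  -- §1: each right translate has the same integral over `S`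
  have hI : ∀ k ∈ (K : Set G), ∫ x in S, φ (x * k) ∂μ = ∫ x in S, φ x ∂μ := fun k hk =>
    setIntegral_comp_mul_right_eq_of_forall_mul_mem_iff μ φ k (hiff k hk)
  -- the integrand `(k, x) ↦ φ (x k)` is integrable on the finite product `μ|K ⊗ μ|S`
  have hcont : Continuous fun p : G × G => φ (p.2 * p.1) := hφ.comp (continuous_snd.mul continuous_fst)
  have hint : Integrable (Function.uncurry fun k x => φ (x * k)) ((μ.restrict (K : Set G)).prod (μ.restrict S)) := by
    have h1 : IntegrableOn (fun p : G × G => φ (p.2 * p.1)) ((K : Set G) ×ˢ closure S) (μ.prod μ) :=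
      hcont.continuousOn.integrableOn_compact (hKc.prod hSc)
    have h2 : IntegrableOn (fun p : G × G => φ (p.2 * p.1)) ((K : Set G) ×ˢ S) (μ.prod μ) :=
      h1.mono_set (Set.prod_mono Subset.rfl subset_closure)
    rw [Measure.prod_restrict]
    exact h2
  -- Fubini
  have hswap : ∫ k in (K : Set G), (∫ x in S, φ (x * k) ∂μ) ∂μ = ∫ x in S, (∫ k in (K : Set G), φ (x * k) ∂μ) ∂μ :=
    integral_integral_swap hint
  have hlhs : ∫ k in (K : Set G), (∫ x in S, φ (x * k) ∂μ) ∂μ = μ.real (K : Set G) • ∫ x in S, φ x ∂μ := by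
    rw [setIntegral_congr_fun hKc.measurableSet hI, setIntegral_const]
  have hrhs : ∫ x in S, (∫ k in (K : Set G), φ (x * k) ∂μ) ∂μ = 0 := by
    rw [setIntegral_congr_fun hSm h0, integral_zero]
  rw [hlhs, hrhs] at hswap
  have hreal : μ.real (K : Set G) ≠ 0 := by
    rw [measureReal_def, ENNReal.toReal_ne_zero]
    exact ⟨hKpos, hKc.measure_ne_top⟩
  exact (smul_eq_zero.1 hswap).resolve_left hreal

/-! ## §3 Conjugating the averaging subgroup: `∫_{yKy⁻¹} φ = ∫_K φ(y k y⁻¹)` -/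

/-- **`∫_{yKy⁻¹} φ(z) dμ(z) = ∫_K φ(y k y⁻¹) dμ(k)`** for `μ` left- and right-invariant (any Haar measure of a unimodular group): Mathlib
`setIntegral_map_equiv` at the measurable equivalence `k ↦ y k y⁻¹`, which preserves `μ`.  With `K = K′ = K₀ ∩ y⁻¹K₀y` this is the passage
`∫_{K₀(y)} f(x k y) dk = ∫_{K′} f(x y k′) dk′` between Harish-Chandra's `K₀(y)` and the level `K′` of the cusp-form cancellation.
[cite: HarishChandra1970, Part VII §2 p. 70; §8 p. 80] [cite: Folland1995, §2.4 Prop. 2.27] -/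
theorem setIntegral_image_conj_eq [Group G] [MeasurableMul G] [μ.IsMulLeftInvariant] [μ.IsMulRightInvariant] (φ : G → E) (K : Set G) (y : G) :
    ∫ z in (fun k => y * k * y⁻¹) '' K, φ z ∂μ = ∫ k in K, φ (y * k * y⁻¹) ∂μ := by
  set e : G ≃ᵐ G := (MeasurableEquiv.mulLeft y).trans (MeasurableEquiv.mulRight y⁻¹) with he
  have hecoe : ∀ k, e k = y * k * y⁻¹ := fun k => by
    rw [he, MeasurableEquiv.trans_apply, MeasurableEquiv.coe_mulLeft, MeasurableEquiv.coe_mulRight]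
  have hmap : Measure.map e μ = μ := by
    rw [he, MeasurableEquiv.coe_trans, ← Measure.map_map (MeasurableEquiv.mulRight y⁻¹).measurable (MeasurableEquiv.mulLeft y).measurable,
      MeasurableEquiv.coe_mulLeft, map_mul_left_eq_self μ y, MeasurableEquiv.coe_mulRight, map_mul_right_eq_self μ y⁻¹]
  have hpre : e ⁻¹' (e '' K) = K := e.injective.preimage_image K
  have h := setIntegral_map_equiv (μ := μ) e φ (e '' K)
  rw [hmap, hpre] at h
  simp only [hecoe] at h
  exact h

/-! ## §4 The two consumer shapes from the vanishing on shells -/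

/-- **`∫_{Ω n} ψ = ∫_{Ω n ∩ Ω R} ψ`** for every `n`, once `∫_{Ω n ∖ Ω R} ψ = 0` for every `n` (Mathlib `integral_inter_add_sdiff`) — the `hcanc` shape
with the compact ball `Bset g := Ω R`. [cite: HarishChandra1970, Part VII §3 p. 71 eq. (1)] -/
theorem setIntegral_eq_setIntegral_inter_of_sdiff_eq_zero (Ω : ℕ → Set G) (hmeas : ∀ n, MeasurableSet (Ω n)) (R : ℕ) (ψ : G → E)
    (hint : ∀ n, IntegrableOn ψ (Ω n) μ) (h0 : ∀ n, ∫ x in Ω n \ Ω R, ψ x ∂μ = 0) (n : ℕ) :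
    ∫ x in Ω n, ψ x ∂μ = ∫ x in Ω n ∩ Ω R, ψ x ∂μ := by
  rw [← integral_inter_add_sdiff (hmeas R) (hint n), h0 n, add_zero]

/-- **`Θₙ → Θ_R`** (indeed `Θₙ = Θ_R` for `n ≥ R`) for a MONOTONE family `Ω`, once `∫_{Ω n ∖ Ω R} ψ = 0` for every `n` — the `hlim` shape with
`F g := Θ_{R(g)}(g)`. [cite: HarishChandra1970, Part VII §3 p. 72] -/
theorem tendsto_setIntegral_of_forall_sdiff_eq_zero (Ω : ℕ → Set G) (hmono : Monotone Ω) (hmeas : ∀ n, MeasurableSet (Ω n)) (R : ℕ)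
    (ψ : G → E) (hint : ∀ n, IntegrableOn ψ (Ω n) μ) (h0 : ∀ n, ∫ x in Ω n \ Ω R, ψ x ∂μ = 0) :
    Tendsto (fun n => ∫ x in Ω n, ψ x ∂μ) atTop (𝓝 (∫ x in Ω R, ψ x ∂μ)) := by
  refine tendsto_atTop_of_eventually_const (i₀ := R) fun n hn => ?_
  rw [setIntegral_eq_setIntegral_inter_of_sdiff_eq_zero μ Ω hmeas R ψ hint h0 n, Set.inter_eq_right.2 (hmono hn)]

end Summit.HodgeConjecture.HodgeConjecture.Cruxes.H413.K2E3RightInvariantSetIntegralVanishing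

end
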